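import Summits.RiemannHypothesis.RiemannHypothesis.Theorems.SuzukiThetaFlowDecay
import Summits.RiemannHypothesis.RiemannHypothesis.Theorems.SuzukiWindowsDoorExplicitOpNorm

/-!
# SuzukiThetaFlowUniformWindows — θ-UNIFORM clean windows of Suzuki's single operator from ONE kernel anchor
# (column DBR; RH-FREE, unconditional)

LINE 1 — LABEL: RH-FREE unconditional finite-window theorems about the explicit operator family `𝖪_θ[t]` ([Su20] (1.4));
bears_on: B-P(P2-flow) → B-P(P2) (Suzuki's clean windows).  WHAT THIS IS NOT: not a positivity statement about `ζ`,
not evidence for or against RH; every window below lies inside Column 2's certified Weil window `t ≤ 1` and is a finite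
instance of the `∀ t`-clause of the RH-EQUIVALENT residual `AllWindowsWitness` (stmt-19733), never evidence for it;
nothing here is progress toward RH.

MECHANISM (the θ-flow decay law `Theorems.SuzukiThetaFlow.thetaFlowDecay`, now a theorem, on the windows `t ≤ 1` where
Weil positivity is the TREE theorem `WeilFormatCData.A1.weilPositivityOn_one`): an operator-norm window
`‖𝖪_{θ₀}[t]‖ < 1 ∀ t ≤ T` at ONE `θ₀` is an `Anchor θ₀ T`, and for `T ≤ 1` an anchor at `θ₀` makes every window
`t ≤ T` free of `±1` for EVERY `θ ≥ θ₀` (`uniformCleanWindow_of_anchor`).  The anchors come from the kernel-proved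
operator-norm windows of eng-3 g4 (`SuzukiWindowsDoorExplicitOpNorm.opNorm_winOp_limKernel_twelve_lt_one`:
`‖𝖪₁₂[t]‖ < 1 ∀ t ≤ 1/2`; `…_twenty_lt_one`: `‖𝖪₂₀[t]‖ < 1 ∀ t ≤ 21/25`), transported to the quadratic-form shape
`OpNormSqLe` of the card through the tree's `L²`-kernel-operator package (`exists_winOp`, `norm_winOp_toLp_sq`).

RESULTS: `anchor_twelve_half : Anchor 12 (1/2)`, `anchor_twenty : Anchor 20 (21/25)`;
**`uniformCleanWindow_twelve_half : ∀ θ ≥ 12, CleanUpTo θ (1/2)`** and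
**`uniformCleanWindow_twenty : ∀ θ ≥ 20, CleanUpTo θ (21/25)`** — beyond the kernel's polar scale law
`t ≤ (θ−1)/28` (`noUnitEigenvalue_limKernel_of_le_polar`) exactly for `θ ∈ (12, 15)` resp. `θ ∈ (20, 24.52)`.
Numerics of record (NOT kernel): ET1b/ET1c certify `‖𝖪₁₂[t]‖ < 1` to `t = 1.4`, `‖𝖪₂₀[t]‖ < 1` to `t = 1.5`.

References: [Su20] M. Suzuki, ASPM 84 (2020) = arXiv:1907.07302, (1.4), Thm 1.2 (K-v).
-/

noncomputable section

-- D-0017: `Summit.<S>.<S>.…` is the designed namespace of a single-problem summit.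
set_option linter.dupNamespace false

open MeasureTheory Set

namespace Summit.RiemannHypothesis.RiemannHypothesis.Theorems.SuzukiThetaFlow

open Literature.NumberTheory.LFunctions Literature.Analysis.OperatorTheory
open Summit.RiemannHypothesis.RiemannHypothesis.Theorems.SuzukiCleanRadius (CleanUpTo)
open Summit.RiemannHypothesis.RiemannHypothesis.Theorems.SuzukiWindowsDoorTempleGalerkin
open Summit.RiemannHypothesis.RiemannHypothesis.Theorems.SuzukiWindowsDoorExplicitOpNorm

/-! ## §1 Operator-norm windows are anchors -/

/-- RH-FREE.  `‖[f]‖²_{L²(S)} = ∫_S f²` for the class of `f ∈ ℒ²(S)`, `S = (−t,t)`. -/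
theorem norm_toLp_sq_eq_l2NormSq {t : ℝ} {f : ℝ → ℝ} (hf : MemLp f 2 (winMeasure t)) :
    ‖hf.toLp f‖ ^ 2 = l2NormSq t f := by
  rw [norm_sq_eq_integral_norm_sq]
  unfold l2NormSq
  refine integral_congr_ae ?_
  filter_upwards [hf.coeFn_toLp] with x hx
  rw [hx, Real.norm_eq_abs, sq_abs]

/-- RH-FREE · **a bounded realisation of `𝖪_θ[t]` bounds the card's quadratic form**: for any bounded `A` on `L²(−t,t)`
with the a.e. kernel formula for `K_θ`, `‖𝖪_θ[t]f‖² ≤ ‖A‖²·‖f‖²` for every `f ∈ L²(−t,t)`, i.e. `OpNormSqLe θ t ‖A‖²`. -/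
theorem opNormSqLe_of_kernelOp {θ t : ℝ}
    {A : Lp ℝ 2 (volume.restrict (Ioo (-t) t)) →L[ℝ] Lp ℝ 2 (volume.restrict (Ioo (-t) t))}
    (hA : ∀ φ, (A φ : ℝ → ℝ) =ᵐ[volume.restrict (Ioo (-t) t)] fun x => ∫ y in Ioo (-t) t, limKernel θ (x + y) * φ y) :
    OpNormSqLe θ t (‖A‖ ^ 2) := by
  intro f hf
  have h1 : ‖A (hf.toLp f)‖ ^ 2 = winNormSq (limKernel θ) t f := norm_winOp_toLp_sq hA hf
  have h2 : ‖A (hf.toLp f)‖ ≤ ‖A‖ * ‖hf.toLp f‖ := A.le_opNorm _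
  calc winNormSq (limKernel θ) t f = ‖A (hf.toLp f)‖ ^ 2 := h1.symm
    _ ≤ (‖A‖ * ‖hf.toLp f‖) ^ 2 := pow_le_pow_left₀ (norm_nonneg _) h2 2
    _ = ‖A‖ ^ 2 * l2NormSq t f := by rw [mul_pow, norm_toLp_sq_eq_l2NormSq hf]

/-- RH-FREE · **operator-norm windows are anchors**: if for every `t ≤ T` every bounded realisation of `𝖪_{θ₀}[t]`
has `‖A‖ < 1`, then `Anchor θ₀ T` (`q(t) = ‖A_t‖² < 1`; a realisation exists by the tree's `L²`-kernel package). -/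
theorem anchor_of_opNorm_lt_one {θ₀ T : ℝ} (hθ₀ : 1 < θ₀)
    (h : ∀ t : ℝ, t ≤ T →
      ∀ A : Lp ℝ 2 (volume.restrict (Ioo (-t) t)) →L[ℝ] Lp ℝ 2 (volume.restrict (Ioo (-t) t)),
        (∀ φ, (A φ : ℝ → ℝ) =ᵐ[volume.restrict (Ioo (-t) t)]
          fun x => ∫ y in Ioo (-t) t, limKernel θ₀ (x + y) * φ y) → ‖A‖ < 1) :
    Anchor θ₀ T := by
  intro t _ htT
  obtain ⟨A, hA⟩ := exists_winOp (Suzuki2020_thm12_continuous hθ₀) t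
  have hlt : ‖A‖ < 1 := h t htT A hA
  refine ⟨‖A‖ ^ 2, ?_, opNormSqLe_of_kernelOp hA⟩
  have h0 : 0 ≤ ‖A‖ := norm_nonneg _
  nlinarith

/-- RH-FREE · **`Anchor 12 (1/2)`** from the kernel window `‖𝖪₁₂[t]‖ < 1 ∀ t ≤ 1/2` (eng-3 g4,
`opNorm_winOp_limKernel_twelve_lt_one`). -/
theorem anchor_twelve_half : Anchor 12 (1 / 2) :=
  anchor_of_opNorm_lt_one (by norm_num) fun _ ht _ hA => opNorm_winOp_limKernel_twelve_lt_one ht hA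

/-- RH-FREE · **`Anchor 20 (21/25)`** from the kernel window `‖𝖪₂₀[t]‖ < 1 ∀ t ≤ 21/25` (eng-3 g4,
`opNorm_winOp_limKernel_twenty_lt_one`). -/
theorem anchor_twenty : Anchor 20 (21 / 25) :=
  anchor_of_opNorm_lt_one (by norm_num) fun _ ht _ hA => opNorm_winOp_limKernel_twenty_lt_one ht hA

/-! ## §2 The θ-uniform clean windows -/

/-- **RH-FREE · UNCONDITIONAL θ-UNIFORM CLEAN WINDOW `∀ θ ≥ 12, CleanUpTo θ (1/2)`**: for every `θ ≥ 12` and every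
`0 ≤ t ≤ 1/2`, `±1` is not an eigenvalue of `𝖪_θ[t]` on `L²(−t,t)` — ONE kernel anchor at `θ = 12` + the θ-flow
decay law + Column 2's `weilPositivityOn_one`.  New kernel content for `θ ∈ (12, 15)` (polar law: `t ≤ (θ−1)/28`).
A finite-window fact about explicit operators; nothing here bears on RH. -/
theorem uniformCleanWindow_twelve_half : UniformCleanWindow 12 (1 / 2) :=
  uniformCleanWindow_of_anchor (by norm_num) (by norm_num) anchor_twelve_half

/-- **RH-FREE · UNCONDITIONAL θ-UNIFORM CLEAN WINDOW `∀ θ ≥ 20, CleanUpTo θ (21/25)`**: for every `θ ≥ 20` and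
every `0 ≤ t ≤ 0.84`, `±1` is not an eigenvalue of `𝖪_θ[t]` — ONE kernel anchor at `θ = 20` + the decay law +
`weilPositivityOn_one`.  New kernel content for `θ ∈ (20, 24.52)`.  Nothing here bears on RH. -/
theorem uniformCleanWindow_twenty : UniformCleanWindow 20 (21 / 25) :=
  uniformCleanWindow_of_anchor (by norm_num) (by norm_num) anchor_twenty

/-- RH-FREE · the same, spelled out: `θ ≥ 12`, `0 ≤ t ≤ 1/2` ⇒ `NoUnitEigenvalue (limKernel θ) t`. -/
theorem noUnitEigenvalue_of_twelve_le {θ t : ℝ} (hθ : 12 ≤ θ) (ht0 : 0 ≤ t) (ht : t ≤ 1 / 2) :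
    NoUnitEigenvalue (limKernel θ) t :=
  uniformCleanWindow_twelve_half θ hθ t ht0 ht

/-- RH-FREE · the same, spelled out: `θ ≥ 20`, `0 ≤ t ≤ 21/25` ⇒ `NoUnitEigenvalue (limKernel θ) t`. -/
theorem noUnitEigenvalue_of_twenty_le {θ t : ℝ} (hθ : 20 ≤ θ) (ht0 : 0 ≤ t) (ht : t ≤ 21 / 25) :
    NoUnitEigenvalue (limKernel θ) t :=
  uniformCleanWindow_twenty θ hθ t ht0 ht

end Summit.RiemannHypothesis.RiemannHypothesis.Theorems.SuzukiThetaFlow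

end
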